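import Literature.MathematicalPhysics.QuantumFieldTheory.Balaban1983to89.Node00.CarriersB13CondTower
import Literature.MathematicalPhysics.QuantumFieldTheory.Balaban1983to89.B13EntrywiseWalks

/-!
# NODE 00 (YM-PLAN Track A) — STAGE 3′(X.B13), STOREY 4 OF THE TERM TOWER OF RECORD: THE H-TOWER KEYED ON NODE A's OBJECT DATA `(P, locF, Δ₀, J, C)` PER TERM
# (`ResidB13D`, the conditioned operator `decoratedOp ∕ ResidB13D.opD` = the junctions' `hKK` right-hand side AS A DEFINITION, the conditioned layer
# `ResidB13D.toC : ResidB13C θ` it determines, the FOUR object identities `hKA2 hKG2 hKloc hKK` DISCHARGED at it, currencies, honesty)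

SUCCESSOR MODULE of `Node00/CarriersB13CondTower` (storey S5, p582159; the N10 [B13] width seat `pub-ymgap-dag-n10-w3` g0 under director-ym LINE №197 ∕
HUMAN RULING D-0149, declarer per dag-lead DEDUP-353 (1)) — the n10-c lane's census v14 «What would move N10 next» item 1 (t-A0′) «def-B13 DEFINES `𝒦` from
`(P, locF, Δ₀, J, C)` ⇒ 51B ∕ 51C append edition with `hKA2 hKG2 hKloc hKK` by `rfl`»: S5 made the first three definitional from ONE operator `KK` per
term; THIS storey makes the fourth (`hKK`) definitional too.  APPEND-ONLY DISCIPLINE: a NEW importing module; S5, S4 (`Node00/CarriersB13KernelTower`), g0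
(`Node00/CarriersB13`), n10-c's `B13Eq111SDecoupling` (`sDecorate`, module 24) and `B13EntrywiseWalks` (`rawEntryTerm`) are untouched and CONSUMED BY NAME.
[Balaban1988RG2Cluster] = T. Bałaban, *Renormalization group approach to lattice gauge field theories. II. Cluster expansions*, Commun. Math. Phys.
**116** (1988) 1–22: p. 3 (§1's prose on the cubes and the parameters s: *"we multiply the term in (1.6) corresponding to ω by ∏ s(Δ_j) … This way the
s-dependent propagators … are defined"*), (1.11) p. 5, (2.5) p. 12, (2.6) pp. 12–13, (2.8) p. 14 (its sentence *"Using these expansions we introduce the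
parameters s, and we apply the decomposition (1.10),"* closes p. 13), (2.14) p. 15 and p. 15 *"𝐔 = U′U, U′ = exp iL⁻¹ηA′ … For the pair (U, 0) the
operators are symmetric, and the measure is positive"* (page pointers located first-hand by lit-balaban r10, `B13-LOCATOR-LEDGER.md` §1);
[13] = [Balaban1985BackgroundPropagators] Thm 3.10 (3.107)–(3.108) p. 416 (the random-walk ∕ entrywise expansion of the fluctuation operator).

THE PIN.  At S5 (`ResidB13C θ`) the operator family `KK Z t σ u` of a term is FREE DATA; the junctions (n10-c modules 32 ∕ 51B ∕ 51C) posit NODE A's OBJECT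
DATA — the fine-bond index `P Z t` located by `locF`, the σ-FREE fluctuation operator `Δ₀ Z t : E₃ → Matrix P P ℂ` on the complex chart ball, the cube
decoration `J Z t` on PAIRS of fine bonds, the REAL local averaging operator `C Z t : Matrix P (Λ ⊕ C₀) ℝ` — and read the operator off them through the
located identity `hKK : KK Z t σ u = Cᵀ · sDecorate_J(½·raw(Δ₀) ⊕ ½·raw(Δ₀)ᵀ)(σ,u) · C` (print's `C\*Δ_k(σ(Z),𝐔,𝐉)C` after (2.5)–(2.6): [13]'s entrywise
expansion of `Δ₀(u)`, symmetrised, each ordered-pair term s-decorated by the cubes its pair meets ((2.8), p. 3, (1.11)), sandwiched by `C`).  THIS STOREY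
MAKES `hKK` DEFINITIONAL: `ResidB13D θ` = every field of `ResidB13C θ` EXCEPT `KK`, PLUS per term the object data `P locF Δ₀ J Cm`; the reference laws
`hK₀ ∕ hpd` (a REAL positive definite `K₀` with `decoratedOp (Δ₀ Z t) (J Z t) (Cm Z t) 0 0 = K₀ ↪ ℂ`) stay the record's LAWS — now laws ON `Δ₀(0), J, C`.
Then (all `def`∕`abbrev`, print's displays): **`decoratedOp Δ₀ J Cm`** (generic, the `hKK` right-hand side verbatim); **`opD Z t := decoratedOp (Δ₀ Z t) (J Z
t) (Cm Z t)`**; **`toC : ResidB13C θ`** (`KK := opD`), hence S5's `toC.toK : ResidB13K θ`, S4's `toC.toK.layer : ResidB13 θ` = THE [B13] LAYER OF RECORD KEYED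
ON THE OBJECT DATA, to which every g0 ∕ g2 ∕ g3 ∕ S4 ∕ S5 object applies BY NAME.

WHAT IS PROVED (kernel bookkeeping, 0 sorry).  §1 the structure, `decoratedOp`, `opD`, `toC`, faces (`rfl`): `toC_KK`, `toC_n ∕ _k ∕ _m₃ ∕ _g ∕ _c ∕ _K₀ ∕
_locN ∕ _X ∕ _uOf ∕ _r ∕ _Y0l ∕ _Pl ∕ _emb`, `c13OfRecord_toC_toK_layer`; **THE JUNCTIONS' FOUR OBJECT IDENTITIES IN THEIR EXACT BINDER SHAPES at `lamK :=
lamD.toC.toK`, `KK := lamD.toC.KK`, `P := lamD.P`, `Δ₀ := lamD.Δ₀`, `J := lamD.J`, `C := lamD.Cm`: `toC_hKK` (`rfl`), `toC_hKA2 ∕ toC_hKG2 ∕ toC_hKloc` (S5's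
faces at `lamD.toC`)**.  KERNEL CERTIFICATE (scratch, farm rc 0, never filed): 51C's `b13LeafOfRecord_layer_of_located_entrywise θ lamD.toC.toK (KK :=
lamD.toC.KK) (P := lamD.P) (locF := lamD.locF) (Δ₀ := lamD.Δ₀) (J := lamD.J) (C := lamD.Cm) (hKA2 := lamD.toC_hKA2) (hKG2 := lamD.toC_hKG2) (hKloc :=
lamD.toC_hKloc) (hKK := lamD.toC_hKK) …` ELABORATES — what the junction still displays is exactly its OTHER binders (Lemma 1–2 located inputs, numerics, the
entrywise letters `hEL` OF `lamD.Δ₀`, the geodesic letter `hGJ` OF `lamD.J`, `hCle hCsupp` OF `lamD.Cm`, `hfibF` OF `lamD.locF`, ONE positivity `hKacc`, far-ness ∕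
multiplicity, the rung, thresholds, `hvol`).  §2 family ∕ Stage-12 currencies: `ResidB13DFam`, `ResidB13DFam.toCFam` (+ `_apply`), `Stage12Params.pinB13D :=
θ.pinB13C (fun P => (lamD P).toC)` (+ `_eq ∕ _X ∕ _admissible_iff ∕ _toStage3Params`).  §3 HONESTY + A6 (director №189): `ResidB13C.withDecoration` (attach
object data to a conditioned layer, keeping its reference laws), **`decoratedOp_unit_zero`** — THE ONE KERNEL COMPUTATION of this storey: for the identity
fluctuation operator on ONE fine bond, NO decoration and `C = [1 | ·]` onto one interior bond, `decoratedOp 1 ∅ C 0 0 = Cᵀ(½·1 + ½·1ᵀ)C = 1` (print's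
symmetrisation computes at the toy) —, the degenerate datum `ResidB13.unitDecorated` over ANY g0 layer (`unitDecorated_frame`, **`unitDecorated_H`**: S4's
relocated lever PERSISTS two storeys down — the H OF RECORD ≡ 0 at a row bond in `Y0l ∩ Pl`; print's `P ⊂ Y₀ᶜ*` of (2.3) is a LAW the data do not carry),
`exists_residB13D_H_layer_eq_zero`, `nonempty_residB13D`, `nonempty_residB13DFam`.

HONEST FRAMING: definitions + `rfl` bookkeeping + one toy matrix computation; `P locF Δ₀ J Cm K₀ locN X uOf r Y0l Pl emb` are DATA — NOTHING of Bałaban's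
`Δ_k`, `G_k(U)`, `Q_k`, the averaging operators or `C^{(k)}` is constructed or asserted here (NODE 00's reading (R), N06's Sect.-B road, def-Y's `OpsY*` own
them: census v14 items 2′ ∕ 3″); what the storey buys is that at `lamD.toC.toK` the junctions read ALL FOUR object identities as `rfl` and their remaining
hypotheses speak of the record's own fields.  Count-neutral; N10 NOT discharged; K1⁷ NOT closed; counts of record unmoved; one finite 𝕋⁴ programme at fixed
ε per run, Bałaban AS PRINTED — the Yang–Mills mass gap (Clay) is NOT proved by any of this; R4 closes the conditional finite-𝕋⁴ rung `BalabanLadder.UV`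
only; nothing continuum ∕ ℝ⁴ ∕ infinite volume ∕ OS.  No `sorry`, no `axiom`, no `opaque`, no `instance` declaration (structure-field instances registered by
`attribute [instance]`, as S4 ∕ S5), no `notation`.
-/

noncomputable section

namespace Literature.MathematicalPhysics.QuantumFieldTheory.Balaban1983to89.Node00

open T4Continuum AveragingRT T4FiniteEpsInhabited FlowStep FlowStepRuns DagBinding T4DatumAssembly
open scoped Matrix
open Literature.MathematicalPhysics.QuantumFieldTheory.Balaban1983to89.TreeLengthTorus (TDom TPt)
open Literature.MathematicalPhysics.QuantumFieldTheory.Balaban1983to89.B13Lemma3TorusTerms (terms)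
open Literature.MathematicalPhysics.QuantumFieldTheory.Balaban1983to89.B5TorusCover (UT)
open Literature.MathematicalPhysics.QuantumFieldTheory.Balaban1983to89.B13Sqrt27Accretive (invSqrt)

/-! ## §1. The decorated residual layer, the conditioned operator of its object data, the conditioned layer it determines, and the faces -/

section Decorated

open Literature.MathematicalPhysics.QuantumFieldTheory.Balaban1983to89.B13Eq111SDecoupling (sDecorate sTerm sTerm_of_empty sTerm_apply sDecorate_apply)
open Literature.MathematicalPhysics.QuantumFieldTheory.Balaban1983to89.B13EntrywiseWalks (rawEntryTerm)

/-- **THE CONDITIONED OPERATOR OF A TERM FROM NODE A's OBJECT DATA** — the junctions' (32 ∕ 51B ∕ 51C) located identity `hKK` as a DEFINITION: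
`K(σ,u) := Cᵀ · sDecorate_J(½·raw(Δ₀) ⊕ ½·raw(Δ₀)ᵀ)(σ,u) · C` — print's `C\*Δ_k(σ(Z),𝐔,𝐉)C` after the conditioning (2.5)–(2.6): the σ-free
fluctuation operator `Δ₀(u)` expanded ENTRYWISE ([13] (3.107): one term per ordered pair of fine bonds, symmetrised), each term s-decorated by the cubes
`J` its pair meets ((2.8), [II] p. 3 and (1.11)), sandwiched by the REAL local averaging operator `C` of (2.5).  An `abbrev` (the junction reads the
display). [cite: Balaban1988RG2Cluster, (2.5)–(2.6) pp.12–13, (2.8) p.14, p.3, (1.11) p.5; Balaban1985BackgroundPropagators, Thm 3.10 (3.107) p.416] -/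
abbrev decoratedOp {n₁ : ℕ} {P B E₃ : Type} [Fintype P] [DecidableEq P] (Δ₀ : E₃ → Matrix P P ℂ) (J : P × P → Finset (TPt 4 n₁))
    (Cm : Matrix P B ℝ) : (TPt 4 n₁ → ℂ) → E₃ → Matrix B B ℂ :=
  fun σ u => ((Cm.map (algebraMap ℝ ℂ))ᵀ *
    sDecorate (fun ω : (P × P) ⊕ (P × P) => J (Sum.elim id id ω))
      (fun ω u => Sum.elim (fun ω => (1 / 2 : ℂ) • rawEntryTerm Δ₀ ω u) (fun ω => (1 / 2 : ℂ) • (rawEntryTerm Δ₀ ω u)ᵀ) ω) σ u *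
    Cm.map (algebraMap ℝ ℂ))

variable (θ : Stage3Params)

/-- **The DECORATED (object-keyed) residual [B13] term layer at Stage-3 parameters `θ`** (DATA): every field of S5's `ResidB13C θ` EXCEPT the operator
`KK`, PLUS per term `t = (𝐃, P)` of every `Z ∈ 𝐃_{k+1}` NODE A's OBJECT DATA behind the junctions' `hKK` — the fine-bond index type `P Z t`, its
location `locF` on [13]'s site torus, the σ-FREE fluctuation operator `Δ₀ Z t : E₃ → Matrix P P ℂ` on the complex chart ball ([13] (3.107)–(3.108)),
the cube decoration `J Z t` on PAIRS of fine bonds ([II] p. 3 and (1.11) p. 5), and the REAL local averaging operator `Cm Z t : Matrix P (Λ ⊕ C₀) ℝ` ((2.5)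
p. 12); the reference laws `hK₀ ∕ hpd` now speak of `decoratedOp (Δ₀ Z t) (J Z t) (Cm Z t)` at `(σ,u) = (0,0)` (p. 15: for the pair `(U, 0)` the
operators are symmetric and the measure is positive).  The operator, the kernels, the (2.14) term, H and the layer of record are then DEFINED from these
(`ResidB13D.toC`, S5's `toK`, S4's `layer`). [cite: Balaban1988RG2Cluster, (2.5)–(2.8) pp.12–14, (2.14) p.15, p.3, (1.11) p.5; Balaban1985BackgroundPropagators, Thm 3.10 p.416] -/
structure ResidB13D where
  /-- coarse torus: `n + 1` LM-cubes per direction (fine torus: `(θ.ℓ₆+1)·(n+1)` M-cubes per direction) -/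
  n : ℕ
  /-- the step index k -/
  k : ℕ
  /-- the configurations (𝐔, 𝐉, B) (complexified), as a complex normed space -/
  Φ : Type
  [normedΦ : NormedAddCommGroup Φ]
  [spaceΦ : NormedSpace ℂ Φ]
  /-- the bonds carrying the fluctuation variable B -/
  Bond : Type
  [finBond : Fintype Bond]
  /-- the space (1.34) of Y ∈ 𝐃_k -/
  sp1 : TDom 4 ((θ.ℓ₆ + 1) * (n + 1)) → Set Φ
  /-- the space Uᶜ_{k+1}(·, α₀, α₁) of p. 15 of Z ∈ 𝐃_{k+1} -/
  sp2 : TDom 4 (n + 1) → Set Φ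
  /-- the bond variables B(b) -/
  Bv : Φ → Bond → ℂ
  /-- (1.33): anchors -/
  S0 : TDom 4 ((θ.ℓ₆ + 1) * (n + 1)) → Finset (TPt 4 ((θ.ℓ₆ + 1) * (n + 1)))
  /-- (1.33): the cubes Y₀ ranges over -/
  F : TDom 4 ((θ.ℓ₆ + 1) * (n + 1)) → TPt 4 ((θ.ℓ₆ + 1) * (n + 1)) → Finset (TPt 4 ((θ.ℓ₆ + 1) * (n + 1)))
  /-- (1.33): the j-cubes -/
  Sq : TDom 4 ((θ.ℓ₆ + 1) * (n + 1)) → TPt 4 ((θ.ℓ₆ + 1) * (n + 1)) → (j : ℕ) →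
    Finset (TPt 4 ((θ.ℓ₆ + 1) ^ (k - j) * ((θ.ℓ₆ + 1) * (n + 1))))
  /-- (1.33): the j-domains -/
  SX : TDom 4 ((θ.ℓ₆ + 1) * (n + 1)) → TPt 4 ((θ.ℓ₆ + 1) * (n + 1)) → (j : ℕ) →
    TPt 4 ((θ.ℓ₆ + 1) ^ (k - j) * ((θ.ℓ₆ + 1) * (n + 1))) → Finset (TDom 4 ((θ.ℓ₆ + 1) ^ (k - j) * ((θ.ℓ₆ + 1) * (n + 1))))
  /-- (1.33): the terms localized in Y -/
  T : TDom 4 ((θ.ℓ₆ + 1) * (n + 1)) → TPt 4 ((θ.ℓ₆ + 1) * (n + 1)) → Finset (TPt 4 ((θ.ℓ₆ + 1) * (n + 1))) → (j : ℕ) →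
    TPt 4 ((θ.ℓ₆ + 1) ^ (k - j) * ((θ.ℓ₆ + 1) * (n + 1))) → TDom 4 ((θ.ℓ₆ + 1) ^ (k - j) * ((θ.ℓ₆ + 1) * (n + 1))) → Φ → ℂ
  /-- (1.33), chain part: anchors -/
  Sc : TDom 4 ((θ.ℓ₆ + 1) * (n + 1)) → Finset (TPt 4 ((θ.ℓ₆ + 1) * (n + 1)))
  /-- (1.33), chain part: j-cubes -/
  Sq' : TDom 4 ((θ.ℓ₆ + 1) * (n + 1)) → TPt 4 ((θ.ℓ₆ + 1) * (n + 1)) → (j : ℕ) →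
    Finset (TPt 4 ((θ.ℓ₆ + 1) ^ (k - j) * ((θ.ℓ₆ + 1) * (n + 1))))
  /-- (1.33), chain part: j-domains -/
  SX' : TDom 4 ((θ.ℓ₆ + 1) * (n + 1)) → TPt 4 ((θ.ℓ₆ + 1) * (n + 1)) → (j : ℕ) →
    TPt 4 ((θ.ℓ₆ + 1) ^ (k - j) * ((θ.ℓ₆ + 1) * (n + 1))) → Finset (TDom 4 ((θ.ℓ₆ + 1) ^ (k - j) * ((θ.ℓ₆ + 1) * (n + 1))))
  /-- (1.33), chain part: terms -/
  T' : TDom 4 ((θ.ℓ₆ + 1) * (n + 1)) → TPt 4 ((θ.ℓ₆ + 1) * (n + 1)) → (j : ℕ) →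
    TPt 4 ((θ.ℓ₆ + 1) ^ (k - j) * ((θ.ℓ₆ + 1) * (n + 1))) → TDom 4 ((θ.ℓ₆ + 1) ^ (k - j) * ((θ.ℓ₆ + 1) * (n + 1))) → Φ → ℂ
  /-- (1.41)–(1.42): the curvature terms -/
  Gl : TDom 4 ((θ.ℓ₆ + 1) * (n + 1)) → Φ → ℂ
  /-- (1.40): the one-plaquette variable space -/
  E : Type
  [normedE : NormedAddCommGroup E]
  [spaceE : NormedSpace ℂ E]
  /-- (1.41): plaquette indices and the plaquettes of Y -/
  ι₂ : Type
  s : TDom 4 ((θ.ℓ₆ + 1) * (n + 1)) → Finset ι₂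
  /-- (1.40)–(1.41): the one-plaquette terms -/
  Wf : TDom 4 ((θ.ℓ₆ + 1) * (n + 1)) → ι₂ → Φ → E → ℂ
  /-- [I] (2.12): the running coupling g_k of B = g_k B′ -/
  g : ℂ
  /-- (1.40): bond-to-plaquette-variable vectors -/
  e : TDom 4 ((θ.ℓ₆ + 1) * (n + 1)) → Bond → E
  /-- (2.3): bond fineness `m₃ + 1` of the terms of H -/
  m₃ : ℕ
  /-- p. 21: E^{(k+1)}(X) -/
  Ek1 : TDom 4 (n + 1) → Φ → ℂ
  /-- p. 21: the log Z^{(k)} terms localized in X -/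
  Elog : TDom 4 (n + 1) → Φ → ℂ
  /-- (I.3.29): gauge invariance -/
  GaugeInv : (Φ → ℂ) → Prop
  /-- (I.1.7) -/
  Repr17 : Prop
  /-- Lemma 3's restriction sentence -/
  Restr : Prop
  /-- the constants of [II] but `L` -/
  c : B13.Consts
  /-- [13]: the dimension index of the site torus of the walks -/
  ν : ℕ
  /-- [13]: the periods of the site torus `UT Nf` -/
  Nf : Fin ν → ℕ
  [neNf : ∀ i, NeZero (Nf i)]
  /-- the configuration argument space of the operators (p. 15: (𝐔, 𝐉) with U = U′U, small A′, J) -/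
  E₃ : Type
  [normedE₃ : NormedAddCommGroup E₃]
  [spaceE₃ : NormedSpace ℂ E₃]
  /-- (2.5) p. 12: the interior (`Z₀`) bond index type of the term `t` of `Z` — the rows of the kernels -/
  Λ : TDom 4 (n + 1) → B13TermIdx θ n m₃ → Type
  [finΛ : ∀ Z t, Fintype (Λ Z t)]
  [decΛ : ∀ Z t, DecidableEq (Λ Z t)]
  /-- (2.5)–(2.6) pp. 12–13: the exterior (`Z₀ᶜ`) bond index type of the term — the extra columns of the Γ-kernel -/
  C₀ : TDom 4 (n + 1) → B13TermIdx θ n m₃ → Type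
  [finC₀ : ∀ Z t, Fintype (C₀ Z t)]
  [decC₀ : ∀ Z t, DecidableEq (C₀ Z t)]
  /-- [13] (3.107): the fine-bond index type of the term (the bonds the fluctuation operator acts on) -/
  P : TDom 4 (n + 1) → B13TermIdx θ n m₃ → Type
  [finP : ∀ Z t, Fintype (P Z t)]
  [decP : ∀ Z t, DecidableEq (P Z t)]
  /-- [13]: the locations of the fine bonds on the site torus -/
  locF : (Z : TDom 4 (n + 1)) → (t : B13TermIdx θ n m₃) → P Z t → UT Nf
  /-- [13] (3.107)–(3.108): the σ-FREE fluctuation operator of the term on the complex chart ball, `u ↦ Δ₀(u)` (DATA: nothing of Bałaban's `Δ_k` is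
  constructed here) -/
  Δ₀ : (Z : TDom 4 (n + 1)) → (t : B13TermIdx θ n m₃) → E₃ → Matrix (P Z t) (P Z t) ℂ
  /-- [II] p. 3 and (1.11) p. 5: the cube decoration — the σ-cubes a pair of fine bonds is coupled through -/
  J : (Z : TDom 4 (n + 1)) → (t : B13TermIdx θ n m₃) → P Z t × P Z t → Finset (TPt 4 (n + 1))
  /-- (2.5) p. 12: the REAL local averaging operator `C` from the fine bonds to the term's bonds `Λ ⊕ C₀` -/
  Cm : (Z : TDom 4 (n + 1)) → (t : B13TermIdx θ n m₃) → Matrix (P Z t) (Λ Z t ⊕ C₀ Z t) ℝ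
  /-- p. 15: the REAL reference value of the operator at `(σ, u) = (0, 0)` (print's pair `(U, 0)`) -/
  K₀ : (Z : TDom 4 (n + 1)) → (t : B13TermIdx θ n m₃) → Matrix (Λ Z t ⊕ C₀ Z t) (Λ Z t ⊕ C₀ Z t) ℝ
  /-- p. 15: the operator AT `(0,0)` IS the real reference value (a law on `Δ₀(0)`, `J`, `C`) -/
  hK₀ : ∀ Z t, decoratedOp (Δ₀ Z t) (J Z t) (Cm Z t) 0 0 = (K₀ Z t).map (algebraMap ℝ ℂ)
  /-- p. 15 («the measure is positive»): the reference value is positive definite -/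
  hpd : ∀ Z t, (K₀ Z t).PosDef
  /-- [13]: the locations of the term's bonds on the site torus -/
  locN : (Z : TDom 4 (n + 1)) → (t : B13TermIdx θ n m₃) → Λ Z t ⊕ C₀ Z t → UT Nf
  /-- p. 13: the σ-region `X` of the term -/
  X : TDom 4 (n + 1) → B13TermIdx θ n m₃ → Finset (UT Nf)
  /-- a fibre bound of the interior bond locations -/
  m : TDom 4 (n + 1) → B13TermIdx θ n m₃ → ℕ
  /-- the interior fibre bound holds -/
  hfib : ∀ Z t (x : UT Nf), (Finset.univ.filter fun i : Λ Z t => locN Z t (Sum.inl i) = x).card ≤ m Z t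
  /-- p. 15: the configuration `u` the operator reads at `φ` -/
  uOf : TDom 4 (n + 1) → B13TermIdx θ n m₃ → Φ → E₃
  /-- (2.14): the radius of the Cauchy contours -/
  r : ℝ
  /-- (2.3): the row bonds of χ_{k,Y₀} -/
  Y0l : (Z : TDom 4 (n + 1)) → (t : B13TermIdx θ n m₃) → Finset (Λ Z t)
  /-- (2.3): the row bonds of P (χᶜ_{k,P}) -/
  Pl : (Z : TDom 4 (n + 1)) → (t : B13TermIdx θ n m₃) → Finset (Λ Z t)
  /-- the configuration `φ` with real fluctuation field `B` on the row bonds -/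
  emb : (Z : TDom 4 (n + 1)) → (t : B13TermIdx θ n m₃) → Φ → (Λ Z t → ℝ) → Φ

attribute [instance] ResidB13D.normedΦ ResidB13D.spaceΦ ResidB13D.finBond ResidB13D.normedE ResidB13D.spaceE ResidB13D.neNf
  ResidB13D.normedE₃ ResidB13D.spaceE₃ ResidB13D.finΛ ResidB13D.decΛ ResidB13D.finC₀ ResidB13D.decC₀ ResidB13D.finP ResidB13D.decP

variable {θ}

namespace ResidB13D

variable (lamD : ResidB13D θ)

/-- **THE CONDITIONED OPERATOR OF THE TERM OF RECORD**: `decoratedOp` at the term's object data. [cite: Balaban1988RG2Cluster, (2.5)–(2.8) pp.12–14; Balaban1985BackgroundPropagators, Thm 3.10 (3.107) p.416] -/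
abbrev opD (Z : TDom 4 (lamD.n + 1)) (t : B13TermIdx θ lamD.n lamD.m₃) :
    (TPt 4 (lamD.n + 1) → ℂ) → lamD.E₃ → Matrix (lamD.Λ Z t ⊕ lamD.C₀ Z t) (lamD.Λ Z t ⊕ lamD.C₀ Z t) ℂ :=
  decoratedOp (lamD.Δ₀ Z t) (lamD.J Z t) (lamD.Cm Z t)

/-- **THE CONDITIONED LAYER DETERMINED BY THE OBJECT DATA** (S5's `ResidB13C θ` with `KK := opD`, every other datum the same): so `toC.toK`, its `T₃`,
`layer`, `H`, and every g0 ∕ g2 ∕ g3 ∕ S4 ∕ S5 object apply BY NAME; an `abbrev`. [cite: Balaban1988RG2Cluster, (2.5)–(2.8) pp.12–14, (2.14) p.15] -/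
abbrev toC : ResidB13C θ where
  n := lamD.n
  k := lamD.k
  Φ := lamD.Φ
  Bond := lamD.Bond
  sp1 := lamD.sp1
  sp2 := lamD.sp2
  Bv := lamD.Bv
  S0 := lamD.S0
  F := lamD.F
  Sq := lamD.Sq
  SX := lamD.SX
  T := lamD.T
  Sc := lamD.Sc
  Sq' := lamD.Sq'
  SX' := lamD.SX'
  T' := lamD.T'
  Gl := lamD.Gl
  E := lamD.E
  ι₂ := lamD.ι₂
  s := lamD.s
  Wf := lamD.Wf
  g := lamD.g
  e := lamD.e
  m₃ := lamD.m₃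
  Ek1 := lamD.Ek1
  Elog := lamD.Elog
  GaugeInv := lamD.GaugeInv
  Repr17 := lamD.Repr17
  Restr := lamD.Restr
  c := lamD.c
  ν := lamD.ν
  Nf := lamD.Nf
  E₃ := lamD.E₃
  Λ := lamD.Λ
  C₀ := lamD.C₀
  KK := lamD.opD
  K₀ := lamD.K₀
  hK₀ := lamD.hK₀
  hpd := lamD.hpd
  locN := lamD.locN
  X := lamD.X
  m := lamD.m
  hfib := lamD.hfib
  uOf := lamD.uOf
  r := lamD.r
  Y0l := lamD.Y0l
  Pl := lamD.Pl
  emb := lamD.emb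

/-! ### Faces (`rfl`) -/

/-- The operator family of the determined conditioned layer IS the decorated operator of the object data.
[cite: Balaban1988RG2Cluster, (2.5)–(2.8) pp.12–14 (bookkeeping)] -/
theorem toC_KK (Z : TDom 4 (lamD.n + 1)) (t : B13TermIdx θ lamD.n lamD.m₃) : lamD.toC.KK Z t = lamD.opD Z t := rfl
/-- [cite: Balaban1988RG2Cluster, (2.14) p.15 (bookkeeping)] -/
theorem toC_n : lamD.toC.n = lamD.n := rfl
/-- [cite: Balaban1988RG2Cluster, (1.33) p.9 (bookkeeping)] -/
theorem toC_k : lamD.toC.k = lamD.k := rfl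
/-- [cite: Balaban1988RG2Cluster, (2.3) p.12 (bookkeeping)] -/
theorem toC_m₃ : lamD.toC.m₃ = lamD.m₃ := rfl
/-- [cite: Balaban1987RG1, (2.12) p.268 (bookkeeping)] -/
theorem toC_g : lamD.toC.g = lamD.g := rfl
/-- [cite: Balaban1988RG2Cluster, p.20 (bookkeeping)] -/
theorem toC_c : lamD.toC.c = lamD.c := rfl
/-- [cite: Balaban1988RG2Cluster, p.15 (bookkeeping)] -/
theorem toC_K₀ : lamD.toC.K₀ = lamD.K₀ := rfl
/-- [cite: Balaban1985BackgroundPropagators, Thm 3.10 p.416 (bookkeeping: bond locations)] -/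
theorem toC_locN : lamD.toC.locN = lamD.locN := rfl
/-- [cite: Balaban1988RG2Cluster, p.13 (bookkeeping: the σ-region)] -/
theorem toC_X : lamD.toC.X = lamD.X := rfl
/-- [cite: Balaban1988RG2Cluster, p.15 (bookkeeping)] -/
theorem toC_uOf : lamD.toC.uOf = lamD.uOf := rfl
/-- [cite: Balaban1988RG2Cluster, (2.14) p.15 (bookkeeping)] -/
theorem toC_r : lamD.toC.r = lamD.r := rfl
/-- [cite: Balaban1988RG2Cluster, (2.3) p.12 (bookkeeping)] -/
theorem toC_Y0l : lamD.toC.Y0l = lamD.Y0l := rfl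
/-- [cite: Balaban1988RG2Cluster, (2.3) p.12 (bookkeeping)] -/
theorem toC_Pl : lamD.toC.Pl = lamD.Pl := rfl
/-- [cite: Balaban1988RG2Cluster, (2.14) p.15 (bookkeeping)] -/
theorem toC_emb : lamD.toC.emb = lamD.emb := rfl

/-- The constants of record of the determined layer of record. [cite: Balaban1988RG2Cluster, p.20 (bookkeeping)] -/
theorem c13OfRecord_toC_toK_layer : c13OfRecord θ lamD.toC.toK.layer = ({ lamD.c with L := θ.ℓ₆ + 1 } : B13.Consts) := rfl

/-! ### The junctions' FOUR located object identities, DISCHARGED at the determined layer (exact binder shapes of 32 ∕ 51B ∕ 51C at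
`lamK := lamD.toC.toK`, `KK := lamD.toC.KK`, `P := lamD.P`, `Δ₀ := lamD.Δ₀`, `J := lamD.J`, `C := lamD.Cm`) -/

/-- **`hKK` DISCHARGED (`rfl`)**: at the determined layer the operator of every term IS `Cᵀ·sDecorate_J(½raw(Δ₀) ⊕ ½raw(Δ₀)ᵀ)·C` of its object data.
[cite: Balaban1988RG2Cluster, (2.5)–(2.8) pp.12–14, p.3, (1.11) p.5; Balaban1985BackgroundPropagators, Thm 3.10 (3.107) p.416] -/
theorem toC_hKK : ∀ (Z : TDom 4 (lamD.toC.toK.n + 1)) (t : B13TermIdx θ lamD.toC.toK.n lamD.toC.toK.m₃) (σ : TPt 4 (lamD.toC.toK.n + 1) → ℂ)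
    (u : lamD.toC.toK.E₃),
    lamD.toC.KK Z t σ u =
      ((lamD.Cm Z t).map (algebraMap ℝ ℂ))ᵀ *
        sDecorate (fun ω : (lamD.P Z t × lamD.P Z t) ⊕ (lamD.P Z t × lamD.P Z t) => lamD.J Z t (Sum.elim id id ω))
          (fun ω u => Sum.elim (fun ω => (1 / 2 : ℂ) • rawEntryTerm (lamD.Δ₀ Z t) ω u)
            (fun ω => (1 / 2 : ℂ) • (rawEntryTerm (lamD.Δ₀ Z t) ω u)ᵀ) ω) σ u *
        (lamD.Cm Z t).map (algebraMap ℝ ℂ) :=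
  fun _ _ _ _ => rfl

/-- **`hKA2` at the decorated tower (`rfl`)**: the precision of every term IS the interior block of the decorated operator.
[cite: Balaban1988RG2Cluster, (2.5) p.12, (2.14) p.15] -/
theorem toC_hKA2 : ∀ (Z : TDom 4 (lamD.toC.toK.n + 1)) (t : B13TermIdx θ lamD.toC.toK.n lamD.toC.toK.m₃) (σ : TPt 4 (lamD.toC.toK.n + 1) → ℂ)
    (u : lamD.toC.toK.E₃), (lamD.toC.toK.𝒦 Z t).A2 σ u = (lamD.toC.KK Z t σ u).toBlocks₁₁ :=
  lamD.toC.toK_hKA2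

/-- **`hKG2` at the decorated tower (`rfl`)**. [cite: Balaban1988RG2Cluster, (2.6)–(2.7) p.13, (2.14) p.15] -/
theorem toC_hKG2 : ∀ (Z : TDom 4 (lamD.toC.toK.n + 1)) (t : B13TermIdx θ lamD.toC.toK.n lamD.toC.toK.m₃) (σ : TPt 4 (lamD.toC.toK.n + 1) → ℂ)
    (u : lamD.toC.toK.E₃), (lamD.toC.toK.𝒦 Z t).G2 σ u
      = Matrix.fromCols (0 : Matrix (lamD.toC.toK.𝒦 Z t).Λ (lamD.toC.toK.𝒦 Z t).Λ ℂ) (lamD.toC.KK Z t σ u).toBlocks₁₂ * invSqrt (lamD.toC.KK Z t σ u) :=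
  lamD.toC.toK_hKG2

/-- **`hKloc` at the decorated tower (`rfl`)**. [cite: Balaban1988RG2Cluster, (2.5) p.12] -/
theorem toC_hKloc : ∀ (Z : TDom 4 (lamD.toC.toK.n + 1)) (t : B13TermIdx θ lamD.toC.toK.n lamD.toC.toK.m₃) (i : (lamD.toC.toK.𝒦 Z t).Λ),
    (lamD.toC.toK.𝒦 Z t).locΛ i = (lamD.toC.toK.𝒦 Z t).locN (Sum.inl i) :=
  lamD.toC.toK_hKloc

end ResidB13D

/-! ## §2. The family and Stage-12 currencies over decorated layers (S5's `ResidB13CFam`, `Stage12Params.pinB13C`, BY NAME) -/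

/-- **A history-indexed decorated [B13] layer.** [cite: Balaban1987RG1, Thm 3 p.264; Balaban1988RG2Cluster, (2.5)–(2.8) pp.12–14, (2.14) p.15] -/
abbrev ResidB13DFam (θ : Stage3Params) := (k : ℕ) → (Fin (k + 1) → ℝ) → ResidB13D θ

/-- Its family of conditioned layers (member-wise `toC`); S5's `ResidB13CFam.toKFam` and S4's `ResidB13KFam.layerFam` then apply by name.
[cite: Balaban1988RG2Cluster, (2.5)–(2.8) pp.12–14, (2.14) p.15; Balaban1987RG1, Thm 3 p.264] -/
def ResidB13DFam.toCFam (lamDF : ResidB13DFam θ) : ResidB13CFam θ := fun k v => (lamDF k v).toC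

/-- Face (`rfl`). [cite: Balaban1988RG2Cluster, (2.14) p.15 (bookkeeping)] -/
theorem ResidB13DFam.toCFam_apply (lamDF : ResidB13DFam θ) (k : ℕ) (v : Fin (k + 1) → ℝ) : ResidB13DFam.toCFam lamDF k v = (lamDF k v).toC := rfl

section Stage12D

variable (F : T4Family) (N : ℕ) [NeZero N]

/-- **The decorated [B13] pin of Stage-12 parameters**: S5's `Stage12Params.pinB13C` (hence S4's `pinB13K`, g2's `pinB13`) at the run-indexed conditioned
layers determined by the object data. [cite: Balaban1988RG2Cluster, Lemmas 1–3 pp.9–20, (2.5)–(2.8) pp.12–14, (2.14) p.15 (objects of record)] -/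
def Stage12Params.pinB13D (θ : Stage12Params F N) (lamD : B12.RunParams → ResidB13D θ.toStage3Params) : Stage12Params F N :=
  θ.pinB13C F N fun P => (lamD P).toC

/-- Unfolding (`rfl`). [cite: Balaban1988RG2Cluster, Lemmas 1–3 pp.9–20 (bookkeeping)] -/
theorem Stage12Params.pinB13D_eq (θ : Stage12Params F N) (lamD : B12.RunParams → ResidB13D θ.toStage3Params) :
    θ.pinB13D F N lamD = θ.pinB13 F N (fun P => (lamD P).toC.toK.layer) := rfl

/-- The pinned carrier family, unfolded (`rfl`). [cite: Balaban1988RG2Cluster, Lemmas 1–3 (bookkeeping)] -/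
theorem Stage12Params.pinB13D_X (θ : Stage12Params F N) (lamD : B12.RunParams → ResidB13D θ.toStage3Params) (P : B12.RunParams) :
    (θ.pinB13D F N lamD).res.X P = (θ.res.X P).withB13OfRecord θ.toStage3Params (lamD P).toC.toK.layer := rfl

/-- The pin touches neither admissibility (`Iff.rfl`) … [cite: Balaban1987RG1, (1.20)–(1.21) p.264 (bookkeeping)] -/
theorem Stage12Params.pinB13D_admissible_iff (θ : Stage12Params F N) (lamD : B12.RunParams → ResidB13D θ.toStage3Params) :
    (θ.pinB13D F N lamD).Admissible F N ↔ θ.Admissible F N := Iff.rfl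

/-- … nor the Stage-3 dictionary (`rfl`). [cite: Balaban1984PropagatorsII, pp.223–250 (bookkeeping)] -/
theorem Stage12Params.pinB13D_toStage3Params (θ : Stage12Params F N) (lamD : B12.RunParams → ResidB13D θ.toStage3Params) :
    (θ.pinB13D F N lamD).toStage3Params = θ.toStage3Params := rfl

end Stage12D

/-! ## §3. Honesty (S4's lever persists two storeys down) and non-vacuity: the toy symmetrisation computes -/

section HonestyD

/-- **Attach NODE A's object data to a conditioned layer** (its operator `KK` is dropped; the operator becomes the decorated display of the data).
[cite: Balaban1988RG2Cluster, (2.5)–(2.8) pp.12–14 (the operator as a display of the object data)] -/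
def ResidB13C.withDecoration (lamC : ResidB13C θ)
    (P : TDom 4 (lamC.n + 1) → B13TermIdx θ lamC.n lamC.m₃ → Type) [finP : ∀ Z t, Fintype (P Z t)] [decP : ∀ Z t, DecidableEq (P Z t)]
    (locF : (Z : TDom 4 (lamC.n + 1)) → (t : B13TermIdx θ lamC.n lamC.m₃) → P Z t → UT lamC.Nf)
    (Δ₀ : (Z : TDom 4 (lamC.n + 1)) → (t : B13TermIdx θ lamC.n lamC.m₃) → lamC.E₃ → Matrix (P Z t) (P Z t) ℂ)
    (J : (Z : TDom 4 (lamC.n + 1)) → (t : B13TermIdx θ lamC.n lamC.m₃) → P Z t × P Z t → Finset (TPt 4 (lamC.n + 1)))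
    (Cm : (Z : TDom 4 (lamC.n + 1)) → (t : B13TermIdx θ lamC.n lamC.m₃) → Matrix (P Z t) (lamC.Λ Z t ⊕ lamC.C₀ Z t) ℝ)
    (hK₀ : ∀ Z t, decoratedOp (Δ₀ Z t) (J Z t) (Cm Z t) 0 0 = (lamC.K₀ Z t).map (algebraMap ℝ ℂ)) : ResidB13D θ where
  n := lamC.n
  k := lamC.k
  Φ := lamC.Φ
  Bond := lamC.Bond
  sp1 := lamC.sp1
  sp2 := lamC.sp2
  Bv := lamC.Bv
  S0 := lamC.S0
  F := lamC.F
  Sq := lamC.Sq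
  SX := lamC.SX
  T := lamC.T
  Sc := lamC.Sc
  Sq' := lamC.Sq'
  SX' := lamC.SX'
  T' := lamC.T'
  Gl := lamC.Gl
  E := lamC.E
  ι₂ := lamC.ι₂
  s := lamC.s
  Wf := lamC.Wf
  g := lamC.g
  e := lamC.e
  m₃ := lamC.m₃
  Ek1 := lamC.Ek1
  Elog := lamC.Elog
  GaugeInv := lamC.GaugeInv
  Repr17 := lamC.Repr17
  Restr := lamC.Restr
  c := lamC.c
  ν := lamC.ν
  Nf := lamC.Nf
  E₃ := lamC.E₃
  Λ := lamC.Λ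
  C₀ := lamC.C₀
  P := P
  locF := locF
  Δ₀ := Δ₀
  J := J
  Cm := Cm
  K₀ := lamC.K₀
  hK₀ := hK₀
  hpd := lamC.hpd
  locN := lamC.locN
  X := lamC.X
  m := lamC.m
  hfib := lamC.hfib
  uOf := lamC.uOf
  r := lamC.r
  Y0l := lamC.Y0l
  Pl := lamC.Pl
  emb := lamC.emb

/-- **THE TOY SYMMETRISATION COMPUTES** (the one kernel computation of this storey): for the IDENTITY fluctuation operator on ONE fine bond (`P := Unit`,
`Δ₀ := 1`), NO decoration (`J := ∅`) and the averaging operator `C := [1 | ·]` onto one interior bond and no exterior bond (`Unit ⊕ Empty`), the decorated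
operator at `(σ,u) = (0,0)` is `Cᵀ(½·1 + ½·1ᵀ)C = 1` — the identity, a REAL positive definite reference value.
[cite: Balaban1988RG2Cluster, (2.5)–(2.8) pp.12–14 (degenerate data); Balaban1985BackgroundPropagators, (3.107) p.416] -/
theorem decoratedOp_unit_zero {n₁ : ℕ} {E₃ : Type} [NormedAddCommGroup E₃] [NormedSpace ℂ E₃] :
    decoratedOp (n₁ := n₁) (fun _ : E₃ => (1 : Matrix Unit Unit ℂ)) (fun _ => ∅)
        (Matrix.of fun (_ : Unit) (j : Unit ⊕ Empty) => Sum.elim (fun _ => (1 : ℝ)) Empty.elim j) 0 0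
      = (1 : Matrix (Unit ⊕ Empty) (Unit ⊕ Empty) ℝ).map (algebraMap ℝ ℂ) := by
  ext i j
  rcases i with ⟨⟨⟩⟩ | ⟨⟨⟩⟩
  rcases j with ⟨⟨⟩⟩ | ⟨⟨⟩⟩
  simp only [decoratedOp, Matrix.mul_apply, Matrix.transpose_apply, Matrix.map_apply, Matrix.of_apply, Sum.elim_inl,
    Fintype.sum_sum_type, Fintype.sum_unique, sDecorate_apply, tsum_fintype, sTerm_apply, Finset.prod_empty, one_mul, Sum.elim_inr,
    Matrix.smul_apply, smul_eq_mul, rawEntryTerm, Matrix.one_apply_eq, and_self, if_true]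
  norm_num

/-- **THE DEGENERATE DECORATED DATUM over a g0 layer** (MODEL, honesty ∕ non-vacuity only): S5's `unitCond` data with the operator now COMPUTED from
the toy object data of `decoratedOp_unit_zero`. [cite: Balaban1988RG2Cluster, (2.3) p.12, (2.5)–(2.8) pp.12–14 (degenerate data)] -/
def ResidB13.unitDecorated (lam : ResidB13 θ) : ResidB13D θ :=
  lam.unitCond.withDecoration (fun _ _ => Unit) (finP := fun _ _ => inferInstanceAs (Fintype Unit))
    (decP := fun _ _ => inferInstanceAs (DecidableEq Unit)) (fun Z t _ => lam.unitCond.locN Z t (Sum.inl ()))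
    (fun _ _ _ => (1 : Matrix Unit Unit ℂ)) (fun _ _ _ => ∅)
    (fun _ _ => Matrix.of fun (_ : Unit) (j : Unit ⊕ Empty) => Sum.elim (fun _ => (1 : ℝ)) Empty.elim j)
    (fun _ _ => decoratedOp_unit_zero)

/-- Its layer of record has the given layer as frame (`rfl`). [cite: Balaban1988RG2Cluster, (2.14) p.15 (bookkeeping)] -/
theorem ResidB13.unitDecorated_frame (lam : ResidB13 θ) : lam.unitDecorated.toC.toK.frame = { lam with T₃ := fun _ _ _ => 0 } := rfl

/-- **HONESTY — S4's RELOCATED LEVER PERSISTS TWO STOREYS DOWN**: at the degenerate decorated datum the H OF RECORD of every `Z` vanishes identically,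
WHATEVER the object data compute (a row bond in `Y0l ∩ Pl`; print's `P ⊂ Y₀ᶜ*` of (2.3) is a LAW the data do not carry).
[cite: Balaban1988RG2Cluster, (2.3) p.12, (2.9) p.14, (2.14) p.15] -/
theorem ResidB13.unitDecorated_H (lam : ResidB13 θ) (Z : TDom 4 (lam.n + 1)) (φ : lam.Φ) : lam.unitDecorated.toC.toK.layer.H Z φ = 0 :=
  ResidB13K.H_layer_eq_zero_of_forall_exists_mem lam.unitDecorated.toC.toK Z (fun _ _ => ⟨(), Finset.mem_univ _, Finset.mem_univ _⟩) φ

/-- **SUCH DECORATED DATA EXIST over every g0 layer, with vanishing H of record.** [cite: Balaban1988RG2Cluster, (2.3) p.12, (2.14) p.15 (degenerate data)] -/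
theorem exists_residB13D_H_layer_eq_zero (lam : ResidB13 θ) :
    ∃ lamD : ResidB13D θ, lamD.toC.toK.frame = { lam with T₃ := fun _ _ _ => 0 } ∧ ∀ Z φ, lamD.toC.toK.layer.H Z φ = 0 :=
  ⟨lam.unitDecorated, lam.unitDecorated_frame, lam.unitDecorated_H⟩

variable (θ) in
/-- The decorated layer type is inhabited. [cite: Balaban1988RG2Cluster, (2.14) p.15 (bookkeeping)] -/
theorem nonempty_residB13D : Nonempty (ResidB13D θ) := by
  obtain ⟨lam⟩ := nonempty_residB13 θ
  exact ⟨lam.unitDecorated⟩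

variable (θ) in
/-- The decorated family type is inhabited. [cite: Balaban1988RG2Cluster, (2.14) p.15 (bookkeeping)] -/
theorem nonempty_residB13DFam : Nonempty (ResidB13DFam θ) := by
  obtain ⟨lamD⟩ := nonempty_residB13D θ
  exact ⟨fun _ _ => lamD⟩

end HonestyD

end Decorated

end Literature.MathematicalPhysics.QuantumFieldTheory.Balaban1983to89.Node00

end
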